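import Summits.CriticalPhenomena.SAWScalingLimit.Theses.SAWMassiveIsingTilt
import Summits.CriticalPhenomena.SAWScalingLimit.Theorems.SAWMassiveIsingTiltDefs
import Literature.Probability.LatticeModels.ModifiedSimonInequality
import HarnessLib

/-!
# Crux `MassiveWindowSLE` (stmt-CriticalPhenomena-7685), line `registered`, skeleton r7 —
# stub `stub_zloopEdgeCalculus` (Malg): the edge calculus of the loop-gas partition function

Route `route-CriticalPhenomena-SAWMassiveIsingTilt` (CriticalPhenomena / SAWScalingLimit). The named
object `Zloop H S y` (`Theorems/SAWMassiveIsingTiltDefs.lean`) is the loop-`O(1)` (high-temperature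
Ising) partition function of the graph `H` read inside the vertex set `S`: the `finsum` over finite
edge sets `E ⊆ E(H)` with all endpoints in `S` and all `E`-degrees even of `y ^ |E|`. This file proves
the pure finite combinatorics consumed verbatim by the mixing stub `stub_zloopRatioMixing_of_locality`
of the skeleton:

* (a) **adding one edge.** For `e₀ = {u, v} ∉ E(H)`, `u ≠ v`, `u, v ∈ S`:
  `Zloop(H + e₀, S; y) = Zloop(H, S; y) + y · W_H(u, v)`, where `W_H(u, v)` is the same sum over the
  edge sets of `H` inside `S` whose odd-degree vertices are exactly `u, v` (the unnormalised Ising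
  two-point function). The even subgraphs of `H + e₀` split into those avoiding `e₀` (= the even
  subgraphs of `H`) and those containing it, `E = E' ∪ {e₀}` with `∂E' = {u, v}` (adding the edge
  `{u, v}` toggles the degree parities at `u` and `v` only: `card_filter_mem_insert` of
  `Literature/Probability/LatticeModels/ModifiedSimonInequality.lean`), and `y ^ (|E'| + 1) = y · y ^ |E'|`.
* (b) **disjoint factorisation.** If the edges of `H₁` have all endpoints in `A` and those of `H₂`
  all endpoints outside `A`, then `Zloop(H₁ ⊔ H₂, S; y) = Zloop(H₁, S; y) · Zloop(H₂, S; y)`: an even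
  edge set of `H₁ ⊔ H₂` is uniquely `E₁ ⊔ E₂` with `E_i ⊆ E(H_i)`; a vertex of `A` only sees
  `H₁`-edges and a vertex outside `A` only `H₂`-edges, so all parities separate, and
  `y ^ (|E₁| + |E₂|) = y ^ |E₁| · y ^ |E₂|`.

Everything is finite under `H.edgeSet.Finite` (the index families are sets of subsets of `E(H)`), so
each `finsum` is an honest `Finset.sum` (`alg_finsum_eq_sum`) and (a), (b) are reindexings
(`Finset.sum_nbij'`). Sources: S. Friedli, Y. Velenik, *Statistical Mechanics of Lattice Systems*
(CUP 2017), §3.7.3 (high-temperature / random-current representation, `∂E`) [FriedliVelenik2017];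
H. Duminil-Copin, S. Smirnov, Ann. of Math. 175 (2012) [DuminilCopinSmirnov2012] (the loop model).
No new facts are cited: Mathlib finite sums and the definition of `Zloop` only.
-/

noncomputable section

namespace Summit.CriticalPhenomena.SAWScalingLimit.Theorems.MassiveWindowSLE.Birth

open scoped BigOperators Topology Classical MeasureTheory NNReal ENNReal
open Filter Set MeasureTheory
open Literature.Probability Literature.Probability.LatticeModels Literature.Probability.RandomPlanarGeometry
open Summit.CriticalPhenomena.SAWScalingLimit.Theorems.SAWMassiveIsingTilt

/-! ### Finiteness: the constrained edge-set families are finite -/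

/-- For a graph with finitely many edges, the family of finite edge sets of `H` inside `S`
satisfying any further constraint `Q` is finite (they are subsets of `E(H)`). -/
theorem alg_finite_setOf_edgeSets {V : Type*} {H : SimpleGraph V} (hH : H.edgeSet.Finite)
    (S : Set V) (Q : Finset (Sym2 V) → Prop) :
    {E : Finset (Sym2 V) | (∀ e ∈ E, e ∈ H.edgeSet ∧ ∀ w ∈ e, w ∈ S) ∧ Q E}.Finite := by
  refine (hH.finite_subsets.preimage Finset.coe_injective.injOn).subset ?_
  intro E hE
  simp only [Set.mem_preimage, Set.mem_setOf_eq, Set.subset_def, Finset.mem_coe]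
  exact fun e he => (hE.1 e he).1

/-- The `finsum` over a constrained edge-set family of a graph with finitely many edges is the
`Finset.sum` over the corresponding finite family. -/
theorem alg_finsum_eq_sum {V : Type*} {H : SimpleGraph V} (hH : H.edgeSet.Finite) (S : Set V)
    (Q : Finset (Sym2 V) → Prop) (f : Finset (Sym2 V) → ℝ) :
    ∑ᶠ E ∈ {E : Finset (Sym2 V) | (∀ e ∈ E, e ∈ H.edgeSet ∧ ∀ w ∈ e, w ∈ S) ∧ Q E}, f E =
      ∑ E ∈ (alg_finite_setOf_edgeSets hH S Q).toFinset, f E :=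
  finsum_mem_eq_finite_toFinset_sum f _

/-! ### (a) Adding one edge -/

/-- The edge set of `H ⊔ {u, v}` (`u ≠ v`) is `E(H) ∪ {{u, v}}`. -/
theorem alg_mem_edgeSet_sup_single {V : Type*} (H : SimpleGraph V) {u v : V} (huv : u ≠ v)
    (e : Sym2 V) :
    e ∈ (H ⊔ SimpleGraph.fromEdgeSet {s(u, v)}).edgeSet ↔ e ∈ H.edgeSet ∨ e = s(u, v) := by
  rw [SimpleGraph.edgeSet_sup, SimpleGraph.edgeSet_fromEdgeSet, Set.mem_union, Set.mem_sdiff,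
    Set.mem_singleton_iff, Sym2.mem_diagSet]
  constructor
  · rintro (h | ⟨h, -⟩)
    · exact Or.inl h
    · exact Or.inr h
  · rintro (h | rfl)
    · exact Or.inl h
    · exact Or.inr ⟨rfl, fun hd => huv (Sym2.mk_isDiag_iff.1 hd)⟩

/-- The edge set of `H ⊔ {u, v}` is finite when that of `H` is. -/
theorem alg_finite_edgeSet_sup_single {V : Type*} {H : SimpleGraph V} (hH : H.edgeSet.Finite)
    (u v : V) : (H ⊔ SimpleGraph.fromEdgeSet {s(u, v)}).edgeSet.Finite := by
  rw [SimpleGraph.edgeSet_sup, SimpleGraph.edgeSet_fromEdgeSet]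
  exact hH.union ((Set.finite_singleton _).subset Set.sdiff_subset)

/-- **(a) Adding one edge.** For `e₀ = {u, v}` not an edge of `H`, `u ≠ v`, `u, v ∈ S`:
`Zloop(H + e₀, S; y) = Zloop(H, S; y) + y · W_H(u, v)` with `W_H(u, v)` the sum of `y ^ |E|` over
the edge sets `E` of `H` inside `S` whose odd vertices are exactly `u` and `v`. -/
theorem alg_zloop_add_edge (H : SimpleGraph HexVertex) (S : Set HexVertex) (y : ℝ)
    (u v : HexVertex) (hH : H.edgeSet.Finite) (huv : u ≠ v) (hadj : ¬ H.Adj u v) (hu : u ∈ S)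
    (hv : v ∈ S) :
    Zloop (H ⊔ SimpleGraph.fromEdgeSet {s(u, v)}) S y = Zloop H S y +
      y * ∑ᶠ E ∈ {E : Finset (Sym2 HexVertex) | (∀ e ∈ E, e ∈ H.edgeSet ∧ ∀ w ∈ e, w ∈ S) ∧
        ∀ w : HexVertex, (Odd (E.filter (fun e => w ∈ e)).card ↔ (w = u ∨ w = v))},
        y ^ E.card := by
  have hH' := alg_finite_edgeSet_sup_single hH u v
  have hmem := alg_mem_edgeSet_sup_single H huv
  have he₀H : s(u, v) ∉ H.edgeSet := fun h => hadj ((SimpleGraph.mem_edgeSet H).1 h)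
  unfold Zloop
  rw [alg_finsum_eq_sum hH' S, alg_finsum_eq_sum hH S, alg_finsum_eq_sum hH S,
    ← Finset.sum_filter_not_add_sum_filter (alg_finite_setOf_edgeSets hH' S _).toFinset
      (fun E => s(u, v) ∈ E)]
  congr 1
  · -- the even subgraphs of `H + e₀` avoiding `e₀` are the even subgraphs of `H`
    refine Finset.sum_congr ?_ (fun _ _ => rfl)
    ext E
    simp only [Finset.mem_filter, Set.Finite.mem_toFinset, Set.mem_setOf_eq]
    constructor
    · rintro ⟨⟨hP, hEv⟩, he₀⟩
      refine ⟨fun e he => ⟨?_, (hP e he).2⟩, hEv⟩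
      rcases (hmem e).1 (hP e he).1 with h | rfl
      · exact h
      · exact absurd he he₀
    · rintro ⟨hP, hEv⟩
      exact ⟨⟨fun e he => ⟨(hmem e).2 (Or.inl (hP e he).1), (hP e he).2⟩, hEv⟩,
        fun he₀ => he₀H (hP _ he₀).1⟩
  · -- the even subgraphs of `H + e₀` through `e₀` are `E' ∪ {e₀}` with `∂E' = {u, v}`
    rw [Finset.mul_sum]
    refine Finset.sum_nbij' (fun E => E.erase s(u, v)) (fun E => insert s(u, v) E) ?_ ?_ ?_ ?_ ?_
    · intro E hE
      simp only [Finset.mem_filter, Set.Finite.mem_toFinset, Set.mem_setOf_eq] at hE ⊢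
      obtain ⟨⟨hP, hEv⟩, he₀E⟩ := hE
      refine ⟨fun e he => ?_, fun w => ?_⟩
      · rw [Finset.mem_erase] at he
        refine ⟨?_, (hP e he.2).2⟩
        rcases (hmem e).1 (hP e he.2).1 with h | h
        · exact h
        · exact absurd h he.1
      · have hk : Even (((insert s(u, v) (E.erase s(u, v))).filter fun e => w ∈ e).card) := by
          rw [Finset.insert_erase he₀E]
          exact hEv w
        rw [card_filter_mem_insert (Finset.notMem_erase _ _)] at hk
        by_cases hw : w ∈ s(u, v)
        · rw [if_pos hw, Nat.even_add_one, Nat.not_even_iff_odd] at hk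
          exact iff_of_true hk (Sym2.mem_iff.1 hw)
        · rw [if_neg hw, add_zero] at hk
          exact iff_of_false (Nat.not_odd_iff_even.2 hk) (fun h => hw (Sym2.mem_iff.2 h))
    · intro E hE
      simp only [Finset.mem_filter, Set.Finite.mem_toFinset, Set.mem_setOf_eq] at hE ⊢
      obtain ⟨hP, hOd⟩ := hE
      have he₀E : s(u, v) ∉ E := fun h => he₀H (hP _ h).1
      refine ⟨⟨fun e he => ?_, fun w => ?_⟩, Finset.mem_insert_self _ _⟩
      · rw [Finset.mem_insert] at he
        rcases he with rfl | he
        · refine ⟨(hmem _).2 (Or.inr rfl), fun w hw => ?_⟩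
          rcases Sym2.mem_iff.1 hw with rfl | rfl
          · exact hu
          · exact hv
        · exact ⟨(hmem e).2 (Or.inl (hP e he).1), (hP e he).2⟩
      · rw [card_filter_mem_insert he₀E]
        by_cases hw : w ∈ s(u, v)
        · rw [if_pos hw, Nat.even_add_one, Nat.not_even_iff_odd]
          exact (hOd w).2 (Sym2.mem_iff.1 hw)
        · rw [if_neg hw, add_zero, ← Nat.not_odd_iff_even]
          exact fun hodd => hw (Sym2.mem_iff.2 ((hOd w).1 hodd))
    · intro E hE
      exact Finset.insert_erase (Finset.mem_filter.1 hE).2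
    · intro E hE
      simp only [Set.Finite.mem_toFinset, Set.mem_setOf_eq] at hE
      exact Finset.erase_insert fun h => he₀H (hE.1 _ h).1
    · intro E hE
      show y ^ E.card = y * y ^ (E.erase s(u, v)).card
      rw [← pow_succ', Finset.card_erase_add_one (Finset.mem_filter.1 hE).2]

/-! ### (b) Disjoint factorisation -/

/-- **(b) Disjoint factorisation.** If every edge of `H₁` has all its endpoints in `A` and every
edge of `H₂` has all its endpoints outside `A`, then
`Zloop(H₁ ⊔ H₂, S; y) = Zloop(H₁, S; y) · Zloop(H₂, S; y)`. -/
theorem alg_zloop_sup_of_separated (H₁ H₂ : SimpleGraph HexVertex) (S A : Set HexVertex) (y : ℝ)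
    (h₁ : H₁.edgeSet.Finite) (h₂ : H₂.edgeSet.Finite) (hA₁ : ∀ e ∈ H₁.edgeSet, ∀ w ∈ e, w ∈ A)
    (hA₂ : ∀ e ∈ H₂.edgeSet, ∀ w ∈ e, w ∉ A) :
    Zloop (H₁ ⊔ H₂) S y = Zloop H₁ S y * Zloop H₂ S y := by
  have h₁₂ : (H₁ ⊔ H₂).edgeSet.Finite := by
    rw [SimpleGraph.edgeSet_sup]
    exact h₁.union h₂
  have hmem : ∀ e, e ∈ (H₁ ⊔ H₂).edgeSet ↔ e ∈ H₁.edgeSet ∨ e ∈ H₂.edgeSet := fun e => by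
    rw [SimpleGraph.edgeSet_sup, Set.mem_union]
  -- an edge of `H₂` is not an edge of `H₁` (its endpoints lie outside, resp. inside, `A`)
  have hdisj : ∀ e ∈ H₂.edgeSet, e ∉ H₁.edgeSet := by
    intro e he₂ he₁
    induction e using Sym2.ind with
    | h a b => exact hA₂ _ he₂ a (Sym2.mem_mk_left a b) (hA₁ _ he₁ a (Sym2.mem_mk_left a b))
  unfold Zloop
  rw [alg_finsum_eq_sum h₁₂ S, alg_finsum_eq_sum h₁ S, alg_finsum_eq_sum h₂ S, Finset.sum_mul_sum,
    ← Finset.sum_product']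
  refine Finset.sum_nbij'
    (fun E => (E.filter (fun e => e ∈ H₁.edgeSet), E.filter (fun e => e ∉ H₁.edgeSet)))
    (fun p => p.1 ∪ p.2) ?_ ?_ ?_ ?_ ?_
  · intro E hE
    simp only [Set.Finite.mem_toFinset, Set.mem_setOf_eq] at hE
    obtain ⟨hP, hEv⟩ := hE
    simp only [Finset.mem_product, Set.Finite.mem_toFinset, Set.mem_setOf_eq]
    refine ⟨⟨fun e he => ?_, fun w => ?_⟩, ⟨fun e he => ?_, fun w => ?_⟩⟩
    · rw [Finset.mem_filter] at he
      exact ⟨he.2, (hP e he.1).2⟩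
    · rw [Finset.filter_filter]
      by_cases hw : w ∈ A
      · have h : E.filter (fun e => e ∈ H₁.edgeSet ∧ w ∈ e) = E.filter (fun e => w ∈ e) := by
          refine Finset.filter_congr (fun e he => ⟨fun h => h.2, fun h => ⟨?_, h⟩⟩)
          rcases (hmem e).1 (hP e he).1 with h1 | h2
          · exact h1
          · exact absurd hw (hA₂ e h2 w h)
        rw [h]
        exact hEv w
      · have h : E.filter (fun e => e ∈ H₁.edgeSet ∧ w ∈ e) = ∅ :=
          Finset.filter_false_of_mem (fun e _ h => hw (hA₁ e h.1 w h.2))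
        rw [h, Finset.card_empty]
        exact Even.zero
    · rw [Finset.mem_filter] at he
      rcases (hmem e).1 (hP e he.1).1 with h | h
      · exact absurd h he.2
      · exact ⟨h, (hP e he.1).2⟩
    · rw [Finset.filter_filter]
      by_cases hw : w ∈ A
      · have h : E.filter (fun e => e ∉ H₁.edgeSet ∧ w ∈ e) = ∅ := by
          refine Finset.filter_false_of_mem (fun e he h => ?_)
          rcases (hmem e).1 (hP e he).1 with h1 | h2
          · exact h.1 h1
          · exact hA₂ e h2 w h.2 hw
        rw [h, Finset.card_empty]
        exact Even.zero
      · have h : E.filter (fun e => e ∉ H₁.edgeSet ∧ w ∈ e) = E.filter (fun e => w ∈ e) :=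
          Finset.filter_congr (fun e _ => ⟨fun h => h.2, fun h => ⟨fun h1 => hw (hA₁ e h1 w h), h⟩⟩)
        rw [h]
        exact hEv w
  · rintro ⟨E₁, E₂⟩ hE
    simp only [Finset.mem_product, Set.Finite.mem_toFinset, Set.mem_setOf_eq] at hE
    obtain ⟨⟨hP₁, hEv₁⟩, ⟨hP₂, hEv₂⟩⟩ := hE
    simp only [Set.Finite.mem_toFinset, Set.mem_setOf_eq]
    refine ⟨fun e he => ?_, fun w => ?_⟩
    · rw [Finset.mem_union] at he
      rcases he with he | he
      · exact ⟨(hmem e).2 (Or.inl (hP₁ e he).1), (hP₁ e he).2⟩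
      · exact ⟨(hmem e).2 (Or.inr (hP₂ e he).1), (hP₂ e he).2⟩
    · rw [Finset.filter_union]
      by_cases hw : w ∈ A
      · have h : E₂.filter (fun e => w ∈ e) = ∅ :=
          Finset.filter_false_of_mem (fun e he h => hA₂ e (hP₂ e he).1 w h hw)
        rw [h, Finset.union_empty]
        exact hEv₁ w
      · have h : E₁.filter (fun e => w ∈ e) = ∅ :=
          Finset.filter_false_of_mem (fun e he h => hw (hA₁ e (hP₁ e he).1 w h))
        rw [h, Finset.empty_union]
        exact hEv₂ w
  · intro E _
    exact Finset.filter_union_filter_not_eq _ _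
  · rintro ⟨E₁, E₂⟩ hE
    simp only [Finset.mem_product, Set.Finite.mem_toFinset, Set.mem_setOf_eq] at hE
    obtain ⟨⟨hP₁, -⟩, ⟨hP₂, -⟩⟩ := hE
    have hE₁ : ∀ e ∈ E₁, e ∈ H₁.edgeSet := fun e he => (hP₁ e he).1
    have hE₂ : ∀ e ∈ E₂, e ∉ H₁.edgeSet := fun e he => hdisj e (hP₂ e he).1
    show ((E₁ ∪ E₂).filter (fun e => e ∈ H₁.edgeSet), (E₁ ∪ E₂).filter (fun e => e ∉ H₁.edgeSet)) =
      (E₁, E₂)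
    rw [Finset.filter_union, Finset.filter_union, Finset.filter_true_of_mem hE₁,
      Finset.filter_false_of_mem hE₂, Finset.union_empty,
      Finset.filter_false_of_mem (fun e he h => h (hE₁ e he)), Finset.filter_true_of_mem hE₂,
      Finset.empty_union]
  · intro E _
    show y ^ E.card = y ^ (E.filter (fun e => e ∈ H₁.edgeSet)).card *
      y ^ (E.filter (fun e => e ∉ H₁.edgeSet)).card
    rw [← pow_add, Finset.card_filter_add_card_filter_not]

/-! ### The registered stub -/

/-- **Stub `stub_zloopEdgeCalculus` (Malg) of line `registered` (skeleton r7) of the crux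
`MassiveWindowSLE`.** The edge calculus of the loop-gas partition function `Zloop(H, S; y)`:
(a) adding one edge `e₀ = {u, v} ∉ E(H)` (`u ≠ v`, `u, v ∈ S`) gives
`Zloop(H + e₀, S; y) = Zloop(H, S; y) + y · W_H(u, v)`, `W_H(u, v)` the sum of `y ^ |E|` over the
edge sets of `H` inside `S` with odd vertices exactly `u, v`; (b) if the edges of `H₁` live inside a
vertex set `A` and those of `H₂` outside `A`, then `Zloop(H₁ ⊔ H₂, S; y) = Zloop(H₁, S; y) · Zloop(H₂, S; y)`. -/
theorem stub_zloopEdgeCalculus :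
    (∀ (H : SimpleGraph Literature.Probability.LatticeModels.HexVertex) (S : Set Literature.Probability.LatticeModels.HexVertex) (y : ℝ) (u v : Literature.Probability.LatticeModels.HexVertex), H.edgeSet.Finite → u ≠ v → ¬ H.Adj u v → u ∈ S → v ∈ S → Summit.CriticalPhenomena.SAWScalingLimit.Theorems.SAWMassiveIsingTilt.Zloop (H ⊔ SimpleGraph.fromEdgeSet {s(u, v)}) S y = Summit.CriticalPhenomena.SAWScalingLimit.Theorems.SAWMassiveIsingTilt.Zloop H S y + y * (∑ᶠ E ∈ {E : Finset (Sym2 Literature.Probability.LatticeModels.HexVertex) | (∀ e ∈ E, e ∈ (H).edgeSet ∧ ∀ w ∈ e, w ∈ S) ∧ ∀ w : Literature.Probability.LatticeModels.HexVertex, (Odd (E.filter (fun e => w ∈ e)).card ↔ (w = u ∨ w = v))}, y ^ E.card)) ∧ (∀ (H₁ H₂ : SimpleGraph Literature.Probability.LatticeModels.HexVertex) (S A : Set Literature.Probability.LatticeModels.HexVertex) (y : ℝ), H₁.edgeSet.Finite → H₂.edgeSet.Finite → (∀ e ∈ H₁.edgeSet, ∀ w ∈ e, w ∈ A) → (∀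 e ∈ H₂.edgeSet, ∀ w ∈ e, w ∉ A) → Summit.CriticalPhenomena.SAWScalingLimit.Theorems.SAWMassiveIsingTilt.Zloop (H₁ ⊔ H₂) S y = Summit.CriticalPhenomena.SAWScalingLimit.Theorems.SAWMassiveIsingTilt.Zloop H₁ S y * Summit.CriticalPhenomena.SAWScalingLimit.Theorems.SAWMassiveIsingTilt.Zloop H₂ S y) :=
  ⟨alg_zloop_add_edge, alg_zloop_sup_of_separated⟩

end Summit.CriticalPhenomena.SAWScalingLimit.Theorems.MassiveWindowSLE.Birth

end
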